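import Summits.Ventures.Crystal3D.Theorems.StickyWulffConstantTextureLiminfCubeRigidityLocalLayers
import HarnessLib

/-!
# TB-1 brick L-PROP-2: LATERAL RE-EXPANSION of a layer datum around ANY centre, with IN-LAYER local hypotheses
# (lane T, crux `TextureLiminfV5`, stmt-Ventures-23912; memo HOME/wulff-p2/g25/SLAB-PLATES-g25.md §4/§6 «descend and re-expand»)

HONEST FRAMING. Venture `Summits/Ventures/Crystal3D` (cell `crystal3d-full`), route `route-Ventures-StickyWulffConstant`, helper `--supports` the
law-v5 crux `TextureLiminfV5` (stmt-Ventures-23912).  Re-runs (census-free, standard axioms) of `layerDisc_hcp` / `layerDisc_fcc`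
('…CubeRigidityLocalLayers', Hales's normalisation) with the centre moved from `0` to an arbitrary centre `c` and the hypothesis «FCC/HCP arrangement at every
centre within `2n + 2` of the origin» replaced by the IN-LAYER local one «at every lattice point `c + latPt i j`, `|i| + |j| ≤ n + 1`, that is a centre».
No cover is built; F-C1 not moved.

WHY.  The slab-local layer recursion ('…TextureBuildLayerPropagation' `exists_local_stacking_slab`, frame form '…LayerPropagationFrame') loses ℓ¹-radius `2`
per layer, while a base chart of radius `r` needs `168r + 196` of defect clearance ('…LocalCharts'); so a single chart cannot feed a descent from the charted
zone to a wall cell's plate with the lateral coverage a plate disc needs (memo §6).  The cure is to RE-EXPAND the layer datum laterally after each descent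
step, as far as the shells IN THAT LAYER stay close-packed — the base-layer propagation of the `CubeRigidity` proof, localised:

* `exists_latPt_add_of_mem_hexagonSet` — a hexagon neighbour of the lattice point `(i, j)` is a lattice point of ℓ¹-index `≤ |i| + |j| + 2`;
* **`layerDisc_hcp_local`** — HCP-type layer (`kissingShell V c = layerShell s s`): if every lattice point `c + latPt i j` with `|i| + |j| ≤ n + 1` that is
  a centre has an FCC- or HCP-type tangent arrangement, the layer datum `LayerDisc V c s s n` holds (all those points ARE centres, with the same shell);
* **`layerDisc_fcc_local`** — FCC-type layer (`layerShell σ σ'`, any signs): the same with FCC arrangements at those points (`ring_of_fcc`).  An HCP-arranged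
  ball inside an FCC-type layer is NOT excluded by the datum — it is the signature of an INCLINED twin plane through that ball (a coherent sub-grain
  boundary, B6's business) — so the FCC case honestly asks for FCC arrangements; where the constructor meets an HCP-arranged ball in an FCC-type layer it
  stops the tent there.
-/

noncomputable section

namespace Summit.Ventures.Crystal3D.Theorems.LocalStacking

open Literature.Geometry.DiscreteGeometry Literature.MathematicalPhysics.StatisticalMechanics
open RealInnerProductSpace Summit.Ventures.Crystal3D.L2B

variable {V : Set (EuclideanSpace ℝ (Fin 3))}

/-- A hexagon neighbour of the lattice point `(i, j)` is the lattice point of an index pair of ℓ¹-norm at most `|i| + |j| + 2`. -/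
theorem exists_latPt_add_of_mem_hexagonSet (i j : ℤ) {η : EuclideanSpace ℝ (Fin 3)} (hη : η ∈ hexagonSet) :
    ∃ i' j' : ℤ, latPt i j + η = latPt i' j' ∧ |i'| + |j'| ≤ |i| + |j| + 2 := by
  rw [hexagonSet_eq_uv] at hη
  simp only [Set.mem_insert_iff, Set.mem_singleton_iff] at hη
  have h1 : |i + 1| ≤ |i| + 1 := by simpa using abs_add_le i 1
  have h2 : |i - 1| ≤ |i| + 1 := by simpa using abs_sub i 1
  have h3 : |j + 1| ≤ |j| + 1 := by simpa using abs_add_le j 1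
  have h4 : |j - 1| ≤ |j| + 1 := by simpa using abs_sub j 1
  rcases hη with rfl | rfl | rfl | rfl | rfl | rfl
  · exact ⟨i + 1, j, (latPt_succ_left i j).symm, by linarith⟩
  · exact ⟨i - 1, j, (latPt_pred_left i j).symm, by linarith⟩
  · exact ⟨i, j + 1, (latPt_succ_right i j).symm, by linarith⟩
  · exact ⟨i, j - 1, (latPt_pred_right i j).symm, by linarith⟩
  · exact ⟨i + 1, j - 1, (latPt_succ_pred i j).symm, by linarith⟩
  · exact ⟨i - 1, j + 1, (latPt_pred_succ i j).symm, by linarith⟩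

/-- **HCP-TYPE LATERAL RE-EXPANSION, local.**  Centre `c ∈ V` with the HCP-type shell `layerShell s s`; FCC/HCP arrangements at the lattice points
`c + latPt i j`, `|i| + |j| ≤ n + 1`, that are centres.  Then the mirror layer is present to ℓ¹-radius `n` around `c`, all with shell `layerShell s s`. -/
theorem layerDisc_hcp_local (hV : IsUnitBallPacking V) {c : EuclideanSpace ℝ (Fin 3)} (hc : c ∈ V) {s : ℝ} (hs : s = 1 ∨ s = -1)
    (hSc : kissingShell V c = layerShell s s) (n : ℤ)
    (hcp : ∀ i j : ℤ, |i| + |j| ≤ n + 1 → c + latPt i j ∈ V →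
      IsArrangedIn (kissingShell V (c + latPt i j)) fccKissingPattern ∨ IsArrangedIn (kissingShell V (c + latPt i j)) hcpKissingPattern) :
    LayerDisc V c s s n := by
  refine disc_induction (Q := fun i j => c + latPt i j ∈ V ∧ kissingShell V (c + latPt i j) = layerShell s s) n
    (by simpa using And.intro hc hSc) ?_
  intro i j hij ⟨hP, hSP⟩
  have go : ∀ η ∈ hexagonSet, c + latPt i j + η ∈ V ∧ kissingShell V (c + latPt i j + η) = layerShell s s := by
    intro η hη
    have hmem : c + latPt i j + η ∈ V :=
      (hSP ▸ hexagonSet_subset_layerShell s s hη : η ∈ kissingShell V (c + latPt i j)).1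
    obtain ⟨i', j', he, hb⟩ := exists_latPt_add_of_mem_hexagonSet i j hη
    have he' : c + latPt i j + η = c + latPt i' j' := by rw [add_assoc, he]
    refine kissingShell_add_eq_layerShell_of_hcp_hexagon hV hs hP hSP hη ?_
    rw [he'] at hmem ⊢
    exact hcp i' j' (by linarith) hmem
  refine ⟨?_, ?_, ?_, ?_⟩
  · rw [latPt_succ_left, ← add_assoc]; exact go _ (by simp [hexagonSet])
  · rw [latPt_pred_left, ← add_assoc]; exact go _ (by simp [hexagonSet])
  · rw [latPt_succ_right, ← add_assoc]; exact go _ (by simp [hexagonSet])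
  · rw [latPt_pred_right, ← add_assoc]; exact go _ (by simp [hexagonSet])

/-- **FCC-TYPE LATERAL RE-EXPANSION, local.**  Centre `c ∈ V` with a layer shell `layerShell σ σ'`; FCC arrangements at the lattice points `c + latPt i j`,
`|i| + |j| ≤ n + 1`, that are centres.  Then the layer is present to ℓ¹-radius `n` around `c`, all with shell `layerShell σ σ'` (the FCC interlocking
`ring_of_fcc` at every disc point). -/
theorem layerDisc_fcc_local (hV : IsUnitBallPacking V) {c : EuclideanSpace ℝ (Fin 3)} (hc : c ∈ V) {σ σ' : ℝ} (hσ : σ = 1 ∨ σ = -1)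
    (hσ' : σ' = 1 ∨ σ' = -1) (hSc : kissingShell V c = layerShell σ σ') (n : ℤ)
    (hfcc : ∀ i j : ℤ, |i| + |j| ≤ n + 1 → c + latPt i j ∈ V → IsArrangedIn (kissingShell V (c + latPt i j)) fccKissingPattern) :
    LayerDisc V c σ σ' n := by
  refine disc_induction (Q := fun i j => c + latPt i j ∈ V ∧ kissingShell V (c + latPt i j) = layerShell σ σ') n
    (by simpa using And.intro hc hSc) ?_
  intro i j hij ⟨hP, hSP⟩
  set P : (EuclideanSpace ℝ (Fin 3)) := c + latPt i j with hPdef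
  have hW : IsUnitBallPacking {z | P + z ∈ V} := isUnitBallPacking_translate hV P
  have hW0 : (0 : (EuclideanSpace ℝ (Fin 3))) ∈ {z | P + z ∈ V} := by simpa using hP
  have hWS : kissingShell {z | P + z ∈ V} 0 = layerShell σ σ' := by rw [kissingShell_translate, add_zero, hSP]
  have hring := ring_of_fcc hW hW0 hσ hσ' hWS (fun η hη => by
    rw [kissingShell_translate]
    have hmem : P + η ∈ V := (hSP ▸ hexagonSet_subset_layerShell σ σ' hη : η ∈ kissingShell V P).1
    obtain ⟨i', j', he, hb⟩ := exists_latPt_add_of_mem_hexagonSet i j hη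
    have he' : P + η = c + latPt i' j' := by rw [hPdef, add_assoc, he]
    rw [he'] at hmem ⊢
    exact hfcc i' j' (by linarith) hmem)
  have go : ∀ η ∈ hexagonSet, P + η ∈ V ∧ kissingShell V (P + η) = layerShell σ σ' := fun η hη =>
    ⟨(hSP ▸ hexagonSet_subset_layerShell σ σ' hη : η ∈ kissingShell V P).1,
      by rw [← kissingShell_translate]; exact hring η hη⟩
  refine ⟨?_, ?_, ?_, ?_⟩
  · rw [latPt_succ_left, ← add_assoc]; exact go _ (by simp [hexagonSet])
  · rw [latPt_pred_left, ← add_assoc]; exact go _ (by simp [hexagonSet])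
  · rw [latPt_succ_right, ← add_assoc]; exact go _ (by simp [hexagonSet])
  · rw [latPt_pred_right, ← add_assoc]; exact go _ (by simp [hexagonSet])

/-- The two local re-expansions together: from a layer datum of radius `0` at `c` (the centre and its shell) and close-packed shells along the layer, the datum
of radius `n` — FCC/HCP arrangements suffice for an HCP-type centre, FCC arrangements for an FCC-type centre. -/
theorem layerDisc_local_of_shell (hV : IsUnitBallPacking V) {c : EuclideanSpace ℝ (Fin 3)} (hc : c ∈ V) {σ σ' : ℝ} (hσ : σ = 1 ∨ σ = -1)
    (hσ' : σ' = 1 ∨ σ' = -1) (hSc : kissingShell V c = layerShell σ σ') (n : ℤ)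
    (hcp : ∀ i j : ℤ, |i| + |j| ≤ n + 1 → c + latPt i j ∈ V →
      IsArrangedIn (kissingShell V (c + latPt i j)) fccKissingPattern ∨
        (σ' = σ ∧ IsArrangedIn (kissingShell V (c + latPt i j)) hcpKissingPattern)) :
    LayerDisc V c σ σ' n := by
  by_cases hss : σ' = σ
  · subst hss
    exact layerDisc_hcp_local hV hc hσ hSc n fun i j hij hm => (hcp i j hij hm).imp id And.right
  · refine layerDisc_fcc_local hV hc hσ hσ' hSc n fun i j hij hm => ?_
    rcases hcp i j hij hm with h | ⟨h, -⟩
    · exact h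
    · exact absurd h hss

end Summit.Ventures.Crystal3D.Theorems.LocalStacking

end
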